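import Literature.MathematicalPhysics.QuantumFieldTheory.Balaban1983to89.T4OutputRate
import Literature.MathematicalPhysics.QuantumFieldTheory.Balaban1983to89.TreeLengthTorus
import Literature.MathematicalPhysics.QuantumFieldTheory.Balaban1983to89.T4LevelShift

/-!
# NE5 ∕ U3 — `B13Carriers`: the CONCRETE `T4OutputRate.Carriers` of the T⁴ setting (row O1-a of the NE5 claim table
# `t4/b2b-balaban-t4-ne5-p1/O1-CLAIM-TABLE-NE5-P1.md`; design `B13StepDesign.md` v0.2 RULE R4)

Cell `pub-balaban`, unit `b2b-balaban-t4-ne5-formalise-leaf-01` (NE5 formalisation swarm, LEAF PROVER 01; trigger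
`t4/T4-NE5-TRIGGER.json`, t4-ref2 pass 58, conditions c1–c6).  Summits-side new work under the LEAN PLACEMENT RULE (cell modelling +
bookkeeping; NOT a Literature module).  HONEST FRAMING: rung (B)+1 of the FINITE-VOLUME T⁴ continuum programme — NOT infinite volume,
NOT a mass gap, NOT the Clay problem, NOT a proof of NE5 (NE5 is NOT PRINTED in [Balaban1987RG1]–[Balaban1989LargeFieldII]; they print
ε-UNIFORM bounds, never η-RATES; cell GAPS G-t4-U3-1).  HONEST DEPENDENCY (cell line, verbatim): continuum YM on T⁴ ⇐ BetaPertH ∧ nine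
spine estimates (0/9 proved); BetaPertH ⇐ (D1) ∧ (D4) ∧ CAP+tail; G-an2-4 gates asym, D1 and NE2/3/4.

WHAT THIS FILE DOES (TYPING ONLY — no estimate, no `def … : Prop` fact, nothing of the audited papers asserted).  The abstract
carrier structure `T4OutputRate.Carriers` (fields `Dom ∕ scale ∕ d ∕ BgA ∕ BgB ∕ gauge ∕ transport`; U3 typing lineage pv05) is
INSTANTIATED — not forked (design Q5) — on the cell's own lattice vocabulary, for the two runs of the T⁴ family
`T4Continuum.T4Family F` (torus of side `2L^m`, [Balaban1987RG1] (0.1) p. 251): run A = `F.P K` (`K` steps, spacing `ε = L^{−K}`),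
run B = `F.P (K + 1)` (spacing `ε/L`), run A's step `j` PAIRED with run B's step `j + 1` (same physical size `L^jε`).  Per RULE R4:
* `Dom` := `Σ j, 𝐃_j` — the localization domains of EVERY creation step `j` (run-A numbering), realised as the tree's TORUS catalogue
  `TreeLengthTorus.TDom 4 (N j)` (unit pv22: non-empty torus-face-connected families of cubes of `π_j`), with `N j = cubesPerDir j`
  := the number of cubes of `π_j` per direction = sites per direction of `T^{(j+m')}` = `2·L^{m+K−j−m'}` (`Params.sitesPerDir`;
  [Balaban1987RG1] p. 257: *"We decompose the space T into the lattice of closed cubes of a size M, where M = L^m, with centers at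
  points of the lattice T_M^{(j+m)}"* — `M = L^{m'}`, `T_M^{(j+m')}` in the renaming of NOTATION.md §2.4; *"The class of all these
  localization domains is denoted by 𝐃_j. Domains from different classes, i.e. classes corresponding to different indices j, are
  connected by scaling transformations."*).  THE PAIRING IS LITERAL ON THIS CARRIER: run B's own scale-`(j+1)` catalogue has the same
  cube count (`cubesPerDir_runB`), so `𝐃^A_j` and `𝐃^B_{j+1}` are the same type — no transport of domains is needed;
* `scale ⟨j, X⟩ := j`; `d ⟨j, X⟩ := torusTreeLen X` = the printed linear size `d_j(X)` on the periodic carrier (p. 257: *"A length of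
  a shortest graph in this class, divided by M, is the linear size of X, and is denoted by d_j(X)"*; covering-space reading D-pv22g2.1
  of `…TreeLengthTorus`), `≥ 0` by `torusTreeLen_nonneg`;
* `BgB` := run B's ADMISSIBLE background configurations on ITS finest lattice `T_{ε/L}` = a SUBTYPE of `GaugeField (F.P (K+1)) 0 G`
  cut out by a class `admB` which is a PARAMETER (the `Carriers` docstring: *"the instancer chooses the subtypes"*); `BgA` likewise on
  run A's finest lattice `T_ε`, class `admA`.  The printed TYPE of such a class is [Balaban1987RG1] (1.2) p. 260 — *"It is defined on
  configurations belonging to the space U_k(ε₀) … the set of all configurations U satisfying the following regularity properties: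
  |U(∂p) − 1| = |(∂U)(p) − 1| < ε₀η², η = L^{−k}, p ∈ T, |J| < ε₀ on T, J = D*_Uη^{−2}π Im ∂U, (1.2) with ε₀ sufficiently small"* —
  and (0.24) p. 257 restricts the representation `𝐄^{(j)}(U) = Σ_{X∈𝐃_j} 𝐄^{(j)}(X, U)` to *"regular gauge field configurations U"*;
  the class itself (it needs the Lie-algebra projection `π Im`) is NOT typed here and is left to row O1-f ∕ the END-face user;
* `transport` := ONE block averaging run B → run A: an abstract one-step averaging `av : Setup.Averaging (F.P (K+1)) 0 G` on run B's
  finest lattice (Bałaban's (0.4)∕(0.11) p. 253, `Ū = M(U)`; the tree's concrete inhabitant is `BlockAveraging.blockAvg ℰ`,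
  specialisation `TwoRuns.balaban`) followed by the LEVEL IDENTIFICATION `T4LevelShift.fieldShift` of run B's level 1 with run A's
  level 0 (`sitesPerDir_ladder`: both have `2·L^{m+K}` sites per direction); the ONE structural requirement — that the transport maps
  run B's class into run A's — is the DISPLAYED field `mapsTo` of the datum (trivial for the unrestricted classes, `TwoRuns.univ`);
  nothing is asserted about Bałaban's minimisers `U_k(V)` ((0.21)∕(1.1));
* `gauge U U'` := the bondwise supremum over run A's finest lattice of the group distance `dist1 (U(b)·U'(b)⁻¹)` (`Setup.GaugeGroup.dist1`
  = `|· − 1|`), the KIND of the sup-conditions (1.2) p. 260 ∕ (1.11)–(1.14) p. 262 (no `η²` normalisation: the consumer shapes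
  `LipBackground` ∕ `BackgroundsClose` carry their own constants); `≥ 0`, symmetric, zero on the diagonal, triangle inequality (§4).
Also (§3): the finite catalogues `domAt j` (all domains of scale `j`) and `domBelow k` (all domains of scale `< k`, the shape of
`InsertionLinearClass.LinearInsertion.dom`), decidable equality of `Dom`, and the two halves of [Balaban1988RG2Cluster] (2.30) p. 18
for `d` on this carrier BY NAME from `…TreeLengthTorus` (`d_le_card_sub_one`, `card_le_of_d`; the lower half in the cell's repaired
form, GAPS G-B13-07).

WHAT IS *NOT* CLAIMED.  (i) No estimate and no hypothesis shape is introduced; rows O1-b…O1-f, O4, O6 and the walls O2∕O3∕O5 are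
untouched.  (ii) The regularity classes `admA`, `admB` and the inclusion `mapsTo` are DATA; that Bałaban's backgrounds `U_K(V)`,
`U_{K+1}(V)` lie in them, or that one block averaging preserves (1.2)-regularity, is NOT asserted (row O1-f displays the one-run
hypotheses; node U1b∕NE3 owns the backgrounds).  (iii) Scales `j` with `j + m' > m + K` are JUNK (truncated subtraction gives
`N j = 2`); the standing range is `j ≤ K` with `m' ≤ m` (at least two big cubes per direction at the unit scale) — a statement that
needs it carries the hypothesis.  (iv) The torus tree length carries conventions D-pv22.1∕D-pv22g2.1 of `…TreeLengthTorus`.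
(v) `E^{(j)}(X, U)` *"depending on U restricted to X"* (0.24) is a property of a functional, not of the carrier, and is not typed here.
Value = typed carrier (leaf L01–L03's index∕background vocabulary fixed for rows O1-b…f), NOT NE5 progress; spine 0∕9.

CITATION HEADER.  T. Bałaban, *Renormalization group approach to lattice gauge field theories. I*, Commun. Math. Phys. **109**,
249–301 (1987) [Balaban1987RG1] (B12; pp. 251, 253, 256–257, 260, 262 — renders `b2b-balaban-ref1/pages/1987-cmp109-rg-I-small-field/
…-p009-x2.png`, `…-p012-x2.png` READ AS IMAGES by this seat for the sentences quoted above; p. 256 (0.21) and p. 262 from the text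
layer); *II. Cluster expansions*, Commun. Math. Phys. **116**, 1–22 (1988) [Balaban1988RG2Cluster] (B13; (2.13) p. 14: the step
produces `𝐄^{(k+1)}(X)`, `X ∈ 𝐃_{k+1}` — locus only; (2.30) p. 18 via `…TreeLengthTorus`).  The manuscripts are UNDER ADJUDICATION:
cited for KIND∕locus only.  Imports BY NAME: `T4OutputRate` (pv05), `TreeLengthTorus` (pv22), `T4LevelShift` (+ `BlockAveraging`,
`Setup`, `T4Continuum` through it); nothing existing is modified.
-/

open scoped BigOperators

namespace Summit.QuantumFields.BalabanUV.T4Continuum.B13Carriers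

open Literature.MathematicalPhysics.QuantumFieldTheory.Balaban1983to89
open Literature.MathematicalPhysics.QuantumFieldTheory.Balaban1983to89.T4OutputRate (Carriers)
open Literature.MathematicalPhysics.QuantumFieldTheory.Balaban1983to89.TreeLengthTorus
open Literature.MathematicalPhysics.QuantumFieldTheory.Balaban1983to89.T4Continuum (T4Family)
open Literature.MathematicalPhysics.QuantumFieldTheory.Balaban1983to89.T4LevelShift

noncomputable section

/-! ## §1 The two runs on the fixed torus: level identification, one-step transport, the datum -/

/-- [folklore] Run A's finest lattice `T_ε` (level 0 of `F.P K`) and run B's level-1 lattice (one averaging above `T_{ε/L}`)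
have the same number of sites per direction, `2·L^{m+K}` (`T4LevelShift.sitesPerDir_ladder`). -/
theorem sitesPerDir_runA_zero (F : T4Family) (K : ℕ) : (F.P K).sitesPerDir 0 = (F.P (K + 1)).sitesPerDir 1 :=
  sitesPerDir_ladder F rfl rfl

/-- [folklore] THE RAW TRANSPORT run B → run A on all configurations: one block averaging `av` on run B's finest lattice
([Balaban1987RG1] (0.4)∕(0.11) p. 253, `Ū = M(U)`), then the level identification `fieldShift` (run B's level 1 = run A's level 0). -/
def transportRaw (F : T4Family) (K : ℕ) {G : Type*} [GaugeGroup G] (av : Averaging (F.P (K + 1)) 0 G)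
    (U : GaugeField (F.P (K + 1)) 0 G) : GaugeField (F.P K) 0 G :=
  fieldShift (sitesPerDir_runA_zero F K) (av.avg U)

/-- [folklore] The raw transport, bondwise: `(transport U)(b) = (M U)(bondShift b)`. -/
@[simp] theorem transportRaw_apply (F : T4Family) (K : ℕ) {G : Type*} [GaugeGroup G] (av : Averaging (F.P (K + 1)) 0 G)
    (U : GaugeField (F.P (K + 1)) 0 G) (b : PBond (F.P K) 0) :
    transportRaw F K av U b = av.avg U (bondShift (sitesPerDir_runA_zero F K) b) :=
  rfl

/-- [folklore] DATA of the two paired runs (no inequality inside): the torus family `F` (side `2L^m`), the number `K` of steps of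
run A (run B has `K + 1`), the big-cube exponent `m'` (`M = L^{m'}`, [Balaban1987RG1] p. 257), the one-step averaging on run B's finest
lattice, the two ADMISSIBLE CLASSES of background configurations (printed TYPE: (1.2) p. 260, *"regular gauge field configurations"*
(0.24) p. 257 — chosen by the instancer) and the displayed requirement that the transport maps run B's class into run A's. -/
structure TwoRuns (G : Type) [GaugeGroup G] where
  /-- the fixed torus family (block size `L`, side `2L^m`) -/
  F : T4Family
  /-- run A = `F.P K` (`ε = L^{−K}`); run B = `F.P (K + 1)` -/
  K : ℕ
  /-- big-cube exponent: the cubes of `π_j` have `M = L^{m'}` sites of `T^{(j)}` per side -/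
  m' : ℕ
  /-- one block averaging on run B's finest lattice (`Setup.Averaging`: covariant, local) -/
  av : Averaging (F.P (K + 1)) 0 G
  /-- run A's admissible backgrounds on `T_ε` -/
  admA : Set (GaugeField (F.P K) 0 G)
  /-- run B's admissible backgrounds on `T_{ε/L}` -/
  admB : Set (GaugeField (F.P (K + 1)) 0 G)
  /-- the transport maps run B's class into run A's (DISPLAYED requirement, not asserted for any particular class) -/
  mapsTo : Set.MapsTo (transportRaw F K av) admB admA

namespace TwoRuns

variable {G : Type} [GaugeGroup G] (R : TwoRuns G)

/-- [folklore] The UNRESTRICTED datum: all configurations admissible on both sides (the requirement `mapsTo` is trivial). -/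
def univ (F : T4Family) (K m' : ℕ) (av : Averaging (F.P (K + 1)) 0 G) : TwoRuns G where
  F := F
  K := K
  m' := m'
  av := av
  admA := Set.univ
  admB := Set.univ
  mapsTo := Set.mapsTo_univ _ _

/-- [folklore] The unrestricted datum admits every run-A configuration. -/
@[simp] theorem univ_admA (F : T4Family) (K m' : ℕ) (av : Averaging (F.P (K + 1)) 0 G) :
    (univ F K m' av).admA = Set.univ := rfl

/-- [folklore] The unrestricted datum admits every run-B configuration. -/
@[simp] theorem univ_admB (F : T4Family) (K m' : ℕ) (av : Averaging (F.P (K + 1)) 0 G) :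
    (univ F K m' av).admB = Set.univ := rfl

/-- [folklore] The datum with BAŁABAN'S SYMMETRIC BLOCK AVERAGING of [Balaban1987RG1] (0.4) p. 253 as the one-step averaging
(the tree's `BlockAveraging.blockAvg ℰ`, `ℰ` an axiomatic small-loop average (0.5)–(0.7)), on given classes. -/
def balaban (F : T4Family) (K m' : ℕ) (ℰ : LoopAverage G) (admA : Set (GaugeField (F.P K) 0 G))
    (admB : Set (GaugeField (F.P (K + 1)) 0 G))
    (h : Set.MapsTo (transportRaw F K (BlockAveraging.blockAvg (P := F.P (K + 1)) (j := 0) ℰ)) admB admA) : TwoRuns G where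
  F := F
  K := K
  m' := m'
  av := BlockAveraging.blockAvg ℰ
  admA := admA
  admB := admB
  mapsTo := h

/-! ## §2 The catalogues `𝐃_j` on the torus and the carriers -/

/-- [folklore] The number of cubes of `π_j` per direction (run-A numbering of scales): the sites per direction of the centre
lattice `T^{(j+m')}` of [Balaban1987RG1] p. 257, i.e. `2·L^{m+K−j−m'}` (`cubesPerDir_eq`). -/
def cubesPerDir (j : ℕ) : ℕ := (R.F.P R.K).sitesPerDir (j + R.m')

/-- [folklore] `cubesPerDir j ≠ 0` (needed by `ZMod` ∕ `TDom`). -/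
instance instNeZeroCubesPerDir (j : ℕ) : NeZero (R.cubesPerDir j) :=
  inferInstanceAs (NeZero ((R.F.P R.K).sitesPerDir (j + R.m')))

/-- [folklore] `cubesPerDir j = 2·L^{m+K−j−m'}` (truncated subtraction: `= 2` on the junk scales `j + m' > m + K`). -/
theorem cubesPerDir_eq (j : ℕ) : R.cubesPerDir j = 2 * R.F.L ^ (R.F.m + R.K - (j + R.m')) := by
  simp [cubesPerDir, Params.sitesPerDir]

/-- [folklore] THE PAIRING IS LITERAL: run B's own scale-`(j+1)` catalogue has the same number of cubes per direction as run A's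
scale-`j` catalogue (both `2·L^{m+K−j−m'}`), so `𝐃^B_{j+1} = 𝐃^A_j` as types ([Balaban1987RG1] p. 257: *"Domains from different
classes … are connected by scaling transformations"*; here the scaling is the identity on cube indices). -/
theorem cubesPerDir_runB (j : ℕ) : (R.F.P (R.K + 1)).sitesPerDir (j + 1 + R.m') = R.cubesPerDir j := by
  simp only [cubesPerDir, Params.sitesPerDir, T4Family.P_L, T4Family.P_m, T4Family.P_K]
  congr 2
  omega

/-- [folklore] There are always at least `2` big cubes per direction (`L ≥ 1`; on the junk scales exactly `2`), recorded for the
cardinality bookkeeping of consumers. -/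
theorem two_le_cubesPerDir (j : ℕ) : 2 ≤ R.cubesPerDir j := by
  rw [cubesPerDir_eq]
  have hL : 1 ≤ R.F.L := by have := R.F.hL.2; omega
  have : 1 ≤ R.F.L ^ (R.F.m + R.K - (j + R.m')) := Nat.one_le_pow _ _ hL
  omega

/-- [folklore] THE DOMAIN INDEX TYPE `Σ_j 𝐃_j`: a creation step `j` and a localization domain of the torus catalogue with
`cubesPerDir j` cubes per direction ([Balaban1987RG1] (0.24) p. 257; `TreeLengthTorus.TDom`). -/
def Dom : Type := Σ j : ℕ, TDom 4 (R.cubesPerDir j)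

/-- [folklore] Decidable equality of torus localization domains (finite sets of cube indices). -/
instance instDecidableEqTDom (d N : ℕ) [NeZero N] : DecidableEq (TDom d N) :=
  inferInstanceAs (DecidableEq {X : Finset (TPt d N) // IsTDom X})

/-- [folklore] Decidable equality of `Dom`. -/
instance instDecidableEqDom : DecidableEq R.Dom :=
  inferInstanceAs (DecidableEq (Σ j : ℕ, TDom 4 (R.cubesPerDir j)))

/-- [folklore] **THE CONCRETE CARRIERS OF THE T⁴ SETTING** (row O1-a; design RULE R4): domains = `Σ_j 𝐃_j` on the torus, `scale` =
creation step, `d` = torus tree length `d_j(X)`, backgrounds = the two runs' admissible configurations on their finest lattices,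
`gauge` = bondwise sup of `dist1`, `transport` = one block averaging + level identification.  No estimate inside. -/
def carriers : Carriers where
  Dom := R.Dom
  scale := fun X => X.1
  d := fun X => torusTreeLen X.2.1
  d_nonneg := fun X => torusTreeLen_nonneg X.2.1
  BgA := ↥R.admA
  BgB := ↥R.admB
  gauge := fun U U' => ⨆ b : PBond (R.F.P R.K) 0, dist1 (U.1 b * (U'.1 b)⁻¹)
  gauge_nonneg := fun _ _ => Real.iSup_nonneg fun _ => GaugeGroup.dist1_nonneg _
  transport := fun U => ⟨transportRaw R.F R.K R.av U.1, R.mapsTo U.2⟩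

/-- [folklore] `scale ⟨j, X⟩ = j`. -/
@[simp] theorem carriers_scale (X : R.carriers.Dom) : R.carriers.scale X = X.1 := rfl

/-- [folklore] `d ⟨j, X⟩ = torusTreeLen X` (the printed `d_j(X)` on the periodic carrier). -/
@[simp] theorem carriers_d (X : R.carriers.Dom) : R.carriers.d X = torusTreeLen X.2.1 := rfl

/-- [folklore] The domain built from a scale and a torus domain. -/
def mkDom (j : ℕ) (X : TDom 4 (R.cubesPerDir j)) : R.carriers.Dom := ⟨j, X⟩

/-- [folklore] `scale (mkDom j X) = j`. -/
@[simp] theorem scale_mkDom (j : ℕ) (X : TDom 4 (R.cubesPerDir j)) : R.carriers.scale (R.mkDom j X) = j := rfl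

/-- [folklore] `d (mkDom j X) = torusTreeLen X`. -/
@[simp] theorem d_mkDom (j : ℕ) (X : TDom 4 (R.cubesPerDir j)) : R.carriers.d (R.mkDom j X) = torusTreeLen X.1 := rfl

/-- [folklore] The transported background is the raw transport of the underlying configuration. -/
@[simp] theorem carriers_transport_val (U : R.carriers.BgB) :
    (R.carriers.transport U).1 = transportRaw R.F R.K R.av U.1 := rfl

/-- [folklore] The transported background, bondwise. -/
theorem carriers_transport_apply (U : R.carriers.BgB) (b : PBond (R.F.P R.K) 0) :
    (R.carriers.transport U).1 b = R.av.avg U.1 (bondShift (sitesPerDir_runA_zero R.F R.K) b) := rfl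

/-- [folklore] The gauge, unfolded. -/
theorem carriers_gauge (U U' : R.carriers.BgA) :
    R.carriers.gauge U U' = ⨆ b : PBond (R.F.P R.K) 0, dist1 (U.1 b * (U'.1 b)⁻¹) := rfl

/-! ## §3 Finite catalogues by scale; (2.30) for `d` on this carrier -/

/-- [folklore] All domains of creation step `j` (the fibre `𝐃_j`, a finite set: `π_j` is finite). -/
def domAt (j : ℕ) : Finset R.carriers.Dom :=
  (Finset.univ : Finset (TDom 4 (R.cubesPerDir j))).map (Function.Embedding.sigmaMk j)

/-- [folklore] Membership in `domAt j` is `scale X = j`. -/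
@[simp] theorem mem_domAt {j : ℕ} {X : R.carriers.Dom} : X ∈ R.domAt j ↔ R.carriers.scale X = j := by
  obtain ⟨i, Y⟩ := X
  simp only [domAt, Finset.mem_map, Finset.mem_univ, true_and, carriers_scale]
  constructor
  · rintro ⟨Z, hZ⟩
    exact (congrArg Sigma.fst hZ).symm
  · rintro rfl
    exact ⟨Y, rfl⟩

/-- [folklore] All domains of creation step `< k` (the shape of `InsertionLinearClass.LinearInsertion.dom k`: only earlier scales
are read by the step-`k` insertion, [Balaban1988RG2Cluster] (1.33) p. 9). -/
def domBelow (k : ℕ) : Finset R.carriers.Dom :=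
  (Finset.range k).sigma fun j => (Finset.univ : Finset (TDom 4 (R.cubesPerDir j)))

/-- [folklore] Membership in `domBelow k` is `scale X < k`. -/
@[simp] theorem mem_domBelow {k : ℕ} {X : R.carriers.Dom} : X ∈ R.domBelow k ↔ R.carriers.scale X < k := by
  refine (Finset.mem_sigma (s := Finset.range k)
    (t := fun j => (Finset.univ : Finset (TDom 4 (R.cubesPerDir j))))).trans ?_
  simp [Finset.mem_range]

/-- [folklore] `domBelow` is monotone in `k`. -/
theorem domBelow_mono {k k' : ℕ} (h : k ≤ k') : R.domBelow k ⊆ R.domBelow k' := fun X hX => by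
  rw [mem_domBelow] at hX ⊢
  exact lt_of_lt_of_le hX h

/-- [folklore] `domAt j ⊆ domBelow k` for `j < k`. -/
theorem domAt_subset_domBelow {j k : ℕ} (h : j < k) : R.domAt j ⊆ R.domBelow k := fun X hX => by
  rw [mem_domAt] at hX
  rw [mem_domBelow, hX]
  exact h

/-- [folklore] The scale-`j` part of `domBelow k` is `domAt j` (for `j < k`) — the filter appearing in
`InsertionLinearClass.LinearInsertion.AgeBudget`. -/
theorem domBelow_filter_scale {j k : ℕ} (h : j < k) :
    (R.domBelow k).filter (fun X => R.carriers.scale X = j) = R.domAt j := by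
  ext X
  simp only [Finset.mem_filter, mem_domBelow, mem_domAt]
  constructor
  · exact fun hX => hX.2
  · intro hX
    exact ⟨hX ▸ h, hX⟩

/-- The UPPER HALF of [Balaban1988RG2Cluster] (2.30) p. 18 on this carrier, BY NAME (`torusTreeLen_le_card_sub_one`, unit pv22):
`d X ≤ #cubes(X) − 1`. [cite: Balaban1988RG2Cluster, (2.30) p.18 (upper half)] -/
theorem d_le_card_sub_one (X : R.carriers.Dom) : R.carriers.d X ≤ (X.2.1.card : ℝ) - 1 :=
  torusTreeLen_le_card_sub_one X.2.2.1 X.2.2.2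

/-- The LOWER HALF of (2.30) in the cell's REPAIRED form (GAPS G-B13-07), BY NAME (`card_le_torusTreeLen`): `#cubes(X) ≤ 2⁴(4·d X + 1)`.
[cite: Balaban1988RG2Cluster, (2.30) p.18 (lower half, repaired form)] -/
theorem card_le_of_d (X : R.carriers.Dom) : (X.2.1.card : ℝ) ≤ 2 ^ 4 * (4 * R.carriers.d X + 1) :=
  card_le_torusTreeLen X.2.2.1 X.2.2.2

/-- [folklore] A domain has at least one cube. -/
theorem one_le_card (X : R.carriers.Dom) : 1 ≤ X.2.1.card := Finset.card_pos.2 X.2.2.1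

/-! ## §4 The gauge: a bondwise-sup pseudo-distance on run A's backgrounds -/

/-- [folklore] Every bondwise distance is below the gauge. -/
theorem dist1_le_gauge (U U' : R.carriers.BgA) (b : PBond (R.F.P R.K) 0) :
    dist1 (U.1 b * (U'.1 b)⁻¹) ≤ R.carriers.gauge U U' :=
  le_ciSup (f := fun b : PBond (R.F.P R.K) 0 => dist1 (U.1 b * (U'.1 b)⁻¹)) (Set.finite_range _).bddAbove b

/-- [folklore] The gauge is below any nonnegative common bound of the bondwise distances. -/
theorem gauge_le {U U' : R.carriers.BgA} {a : ℝ} (h : ∀ b : PBond (R.F.P R.K) 0, dist1 (U.1 b * (U'.1 b)⁻¹) ≤ a)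
    (ha : 0 ≤ a) : R.carriers.gauge U U' ≤ a :=
  Real.iSup_le h ha

/-- [folklore] The gauge vanishes on the diagonal. -/
@[simp] theorem gauge_self (U : R.carriers.BgA) : R.carriers.gauge U U = 0 := by
  refine le_antisymm (R.gauge_le (fun b => ?_) le_rfl) (R.carriers.gauge_nonneg U U)
  rw [mul_inv_cancel, GaugeGroup.dist1_one]

/-- [folklore] The gauge is symmetric (`dist1 g⁻¹ = dist1 g`). -/
theorem gauge_comm (U U' : R.carriers.BgA) : R.carriers.gauge U U' = R.carriers.gauge U' U := by
  have key : ∀ (V V' : R.carriers.BgA), R.carriers.gauge V V' ≤ R.carriers.gauge V' V := fun V V' =>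
    R.gauge_le (fun b => by
      have h := R.dist1_le_gauge V' V b
      rwa [← GaugeGroup.dist1_inv, mul_inv_rev, inv_inv] at h) (R.carriers.gauge_nonneg _ _)
  exact le_antisymm (key U U') (key U' U)

/-- [folklore] The gauge satisfies the triangle inequality (`dist1 (gh) ≤ dist1 g + dist1 h`). -/
theorem gauge_triangle (U V W : R.carriers.BgA) :
    R.carriers.gauge U W ≤ R.carriers.gauge U V + R.carriers.gauge V W := by
  refine R.gauge_le (fun b => ?_) (add_nonneg (R.carriers.gauge_nonneg _ _) (R.carriers.gauge_nonneg _ _))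
  have h : U.1 b * (W.1 b)⁻¹ = (U.1 b * (V.1 b)⁻¹) * (V.1 b * (W.1 b)⁻¹) := by group
  rw [h]
  exact (GaugeGroup.dist1_mul_le _ _).trans (add_le_add (R.dist1_le_gauge U V b) (R.dist1_le_gauge V W b))

end TwoRuns

/-! ## §5 Non-vacuity: single cubes are domains of size 0; `Dom` is inhabited; the unrestricted transport is total -/

/-- [folklore] A single cube of the torus is torus-face-connected (the chain of length 0). -/
theorem tFaceConnected_singleton {d N : ℕ} (a : TPt d N) : TFaceConnected ({a} : Finset (TPt d N)) := by
  intro x hx y hy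
  rw [Finset.mem_singleton] at hx hy
  subst hx
  subst hy
  exact Relation.ReflTransGen.refl

/-- [folklore] Every cube `□ ∈ π_j` is a localization domain ([Balaban1987RG1] p. 257: a domain is *"a union of a connected, finite
family of cubes from π_j"*; one cube is such a family). -/
def singleDom {d N : ℕ} [NeZero N] (a : TPt d N) : TDom d N :=
  ⟨{a}, Finset.singleton_nonempty a, tFaceConnected_singleton a⟩

/-- [folklore] The cube set of `singleDom a` is `{a}`. -/
@[simp] theorem singleDom_val {d N : ℕ} [NeZero N] (a : TPt d N) : (singleDom a).1 = {a} := rfl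

namespace TwoRuns

variable {G : Type} [GaugeGroup G] (R : TwoRuns G)

/-- [folklore] A single cube has linear size `d_j = 0` (`torusTreeLen_singleton`). -/
@[simp] theorem d_singleDom (j : ℕ) (a : TPt 4 (R.cubesPerDir j)) : R.carriers.d (R.mkDom j (singleDom a)) = 0 := by
  rw [d_mkDom, singleDom_val, torusTreeLen_singleton]

/-- [folklore] `Dom` is inhabited (the cube with index `0` at scale `0`). -/
instance instInhabitedDom : Inhabited R.carriers.Dom := ⟨R.mkDom 0 (singleDom 0)⟩

/-- [folklore] Every scale has a domain: `domAt j` is non-empty. -/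
theorem domAt_nonempty (j : ℕ) : (R.domAt j).Nonempty :=
  ⟨R.mkDom j (singleDom 0), R.mem_domAt.2 rfl⟩

/-- [folklore] Non-vacuity of the datum: with the unrestricted classes the transport is the total map
`U ↦ fieldShift (M U)` on ALL run-B configurations (no admissibility obligation arises). -/
example (F : T4Family) (K m' : ℕ) (av : Averaging (F.P (K + 1)) 0 G) (U : GaugeField (F.P (K + 1)) 0 G) :
    ((univ F K m' av).carriers.transport ⟨U, Set.mem_univ U⟩).1 = transportRaw F K av U := rfl

end TwoRuns

end

end Summit.QuantumFields.BalabanUV.T4Continuum.B13Carriers
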